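import Mathlib
import Summits.MatrixMultiplication.MatrixMultiplication.Theses.LevelGradedCohnUmans
import Literature.Combinatorics.Additive.TripleProductProperty

/-!
# Sketch — crux `LevelOneGL2Designs` (stmt-MatrixMultiplication-14080), ideator 2, round 1

First lemmas of the two idea cards filed by this seat:

* `abelian_coset_squeeze`, `card_mul_le_of_cosetCount` — the CENTRAL / ABELIAN SQUEEZE
  (card `centre-checksum-sections`): for a TPP triple and ANY abelian subgroup `A`, the three fibres
  over any three right cosets of `A` have product of sizes `≤ |A|`; hence
  `|S||T||U| ≤ N₁ N₂ N₃ |A|` when `S, T, U` meet `N₁, N₂, N₃` right cosets of `A`.  PROVED below.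
* `sep_slice_YZ` — the SLICE IDENTITY of the separation clause (fix `x = x₀`): `Z` is level-1
  isolated inside `Q(Y)·Z`.  PROVED below (translation invariance of `F_1`).
* `nearIsotropy_levelOne` — NEAR-ISOTROPY AT THE CRITICAL LEVEL `(m,k) = (2,1)` (card
  `det-twist-near-isotropy`): `|X||Z| + |X⁻¹YY⁻¹Z| ≤ |GL₂(𝔽_p)| + (p+1)²`.  Statement only (`sorry`);
  informal proof in the card: `⟨f·θ∘det, f'⟩ = Φ*(K̄_θ ⊗ K_θ)Φ'` has rank `≤ (p+1)²` on `F_1 × F_1`.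

Vocabulary (`fourierFn`, `RankSupp`, `RankSep`, `quadProducts`) is copied verbatim from the parent
crux's `Cruxes/LieRankDesigns/Disproof.lean` so that every statement is definitionally the crux's
inlined clause at `m = 2`, `k = 1`.
-/

set_option linter.unusedVariables false
set_option linter.dupNamespace false
set_option linter.unusedSectionVars false

noncomputable section

open scoped BigOperators

namespace Summit.MatrixMultiplication.MatrixMultiplication.Cruxes.LevelOneGL2Designs.Ideator2

open Summit.MatrixMultiplication.MatrixMultiplication.Theses.LevelGradedCohnUmans
open Literature.Combinatorics.Additive

/-! ## 1. The abelian coset squeeze (pure TPP, any finite group) -/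

section Squeeze

variable {G : Type*} [Group G] [DecidableEq G]

/-- The fibre of a finite set `S` over the right coset `A·g`: `{s ∈ S : s g⁻¹ ∈ A}`. -/
def fibre (A : Subgroup G) [DecidablePred (· ∈ A)] (S : Finset G) (g : G) : Finset G :=
  S.filter fun s => s * g⁻¹ ∈ A

omit [DecidableEq G] in
theorem mem_fibre {A : Subgroup G} [DecidablePred (· ∈ A)] {S : Finset G} {g s : G} :
    s ∈ fibre A S g ↔ s ∈ S ∧ s * g⁻¹ ∈ A := Finset.mem_filter

/-- **Abelian coset squeeze.**  If `(S, T, U)` has the triple product property in `G` and `A ≤ G`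
is an ABELIAN subgroup (not necessarily normal), then for any three right cosets `A g₁, A g₂, A g₃`
the fibres satisfy `|S ∩ A g₁| · |T ∩ A g₂| · |U ∩ A g₃| ≤ |A|`.
Proof: right-translating each fibre into `A` preserves all quotients `s s'⁻¹`, so the translated
fibres form a TPP triple inside the abelian group `A`, where `(a, b, c) ↦ a b c` is injective. -/
theorem abelian_coset_squeeze [Fintype G] (A : Subgroup G) [DecidablePred (· ∈ A)]
    (hA : ∀ a ∈ A, ∀ b ∈ A, a * b = b * a)
    {S T U : Finset G} (h : TripleProductProperty S T U) (g₁ g₂ g₃ : G) :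
    (fibre A S g₁).card * (fibre A T g₂).card * (fibre A U g₃).card ≤ Nat.card A := by
  classical
  -- the product map into `A`
  let F : (fibre A S g₁) × (fibre A T g₂) × (fibre A U g₃) → A := fun x =>
    ⟨(x.1 : G) * g₁⁻¹ * ((x.2.1 : G) * g₂⁻¹) * ((x.2.2 : G) * g₃⁻¹),
      A.mul_mem (A.mul_mem (mem_fibre.1 x.1.2).2 (mem_fibre.1 x.2.1.2).2) (mem_fibre.1 x.2.2.2).2⟩
  have hF : Function.Injective F := by
    rintro ⟨⟨s, hs⟩, ⟨t, ht⟩, ⟨u, hu⟩⟩ ⟨⟨s', hs'⟩, ⟨t', ht'⟩, ⟨u', hu'⟩⟩ he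
    have he' : s * g₁⁻¹ * (t * g₂⁻¹) * (u * g₃⁻¹) = s' * g₁⁻¹ * (t' * g₂⁻¹) * (u' * g₃⁻¹) :=
      congrArg Subtype.val he
    obtain ⟨hsS, hsA⟩ := mem_fibre.1 hs
    obtain ⟨htT, htA⟩ := mem_fibre.1 ht
    obtain ⟨huU, huA⟩ := mem_fibre.1 hu
    obtain ⟨hsS', hsA'⟩ := mem_fibre.1 hs'
    obtain ⟨htT', htA'⟩ := mem_fibre.1 ht'
    obtain ⟨huU', huA'⟩ := mem_fibre.1 hu'
    -- abbreviations for the translated elements (all in `A`)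
    set a := s * g₁⁻¹ with ha
    set b := t * g₂⁻¹ with hb
    set c := u * g₃⁻¹ with hc
    set a' := s' * g₁⁻¹ with ha'
    set b' := t' * g₂⁻¹ with hb'
    set c' := u' * g₃⁻¹ with hc'
    -- from `a b c = a' b' c'` and commutativity inside `A`: `a a'⁻¹ (b b'⁻¹) (c c'⁻¹) = 1`
    have hcomm1 : b * c * c'⁻¹ * b'⁻¹ = b * b'⁻¹ * (c * c'⁻¹) := by
      have h1 : c * c'⁻¹ * b'⁻¹ = b'⁻¹ * (c * c'⁻¹) :=
        hA _ (A.mul_mem huA (A.inv_mem huA')) _ (A.inv_mem htA')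
      calc b * c * c'⁻¹ * b'⁻¹ = b * (c * c'⁻¹ * b'⁻¹) := by group
        _ = b * (b'⁻¹ * (c * c'⁻¹)) := by rw [h1]
        _ = b * b'⁻¹ * (c * c'⁻¹) := by group
    have hrel : a * a'⁻¹ * (b * b'⁻¹) * (c * c'⁻¹) = 1 := by
      have h2 : a * b * c = a' * b' * c' := he'
      have h3 : b * c * c'⁻¹ * b'⁻¹ = a⁻¹ * a' := by
        calc b * c * c'⁻¹ * b'⁻¹ = a⁻¹ * (a * b * c) * c'⁻¹ * b'⁻¹ := by group
          _ = a⁻¹ * (a' * b' * c') * c'⁻¹ * b'⁻¹ := by rw [h2]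
          _ = a⁻¹ * a' := by group
      have h4 : b * b'⁻¹ * (c * c'⁻¹) = a⁻¹ * a' := by rw [← hcomm1, h3]
      calc a * a'⁻¹ * (b * b'⁻¹) * (c * c'⁻¹) = a * a'⁻¹ * (a⁻¹ * a') := by rw [mul_assoc, h4]
        _ = a * (a'⁻¹ * a⁻¹) * a' := by group
        _ = a * (a⁻¹ * a'⁻¹) * a' := by
            rw [hA _ (A.inv_mem hsA') _ (A.inv_mem hsA)]
        _ = 1 := by group
    -- translate back: `a a'⁻¹ = s s'⁻¹` etc.
    have hss : a * a'⁻¹ = s * s'⁻¹ := by simp only [ha, ha']; group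
    have htt : b * b'⁻¹ = t * t'⁻¹ := by simp only [hb, hb']; group
    have huu : c * c'⁻¹ = u * u'⁻¹ := by simp only [hc, hc']; group
    rw [hss, htt, huu] at hrel
    obtain ⟨rfl, rfl, rfl⟩ := h s hsS s' hsS' t htT t' htT' u huU u' huU' hrel
    rfl
  have hcard := Fintype.card_le_of_injective F hF
  simpa [Fintype.card_prod, Fintype.card_coe, Nat.card_eq_fintype_card, mul_assoc] using hcard

/-- **Counting form (the CENTRAL SQUEEZE when `A = Z(G)`).**  If `S, T, U` meet at most the right
cosets `A·g`, `g ∈ R₁` (resp. `R₂`, `R₃`), then `|S| |T| |U| ≤ |R₁| |R₂| |R₃| · |A|`.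
For `G = GL₂(𝔽_p)`, `A = Z(G) ≅ 𝔽_p^×`: `V ≤ (p−1)·N_X N_Y N_Z` with `N` = number of points of
`PGL₂(𝔽_p)` under the piece; a piece inside a coset of a torus (or its normaliser) has
`N ≤ 2(p+1)`, so three-tori designs have `V ≤ 8(p+1)³(p−1)` — the exponent-3 line. -/
theorem card_mul_le_of_cosetCount [Fintype G] (A : Subgroup G) [DecidablePred (· ∈ A)]
    (hA : ∀ a ∈ A, ∀ b ∈ A, a * b = b * a)
    {S T U : Finset G} (h : TripleProductProperty S T U) (R₁ R₂ R₃ : Finset G)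
    (hS : ∀ s ∈ S, ∃ g ∈ R₁, s * g⁻¹ ∈ A) (hT : ∀ t ∈ T, ∃ g ∈ R₂, t * g⁻¹ ∈ A)
    (hU : ∀ u ∈ U, ∃ g ∈ R₃, u * g⁻¹ ∈ A) :
    S.card * T.card * U.card ≤ R₁.card * R₂.card * R₃.card * Nat.card A := by
  classical
  have cS : S.card ≤ ∑ g ∈ R₁, (fibre A S g).card := by
    calc S.card ≤ (R₁.biUnion fun g => fibre A S g).card := by
          refine Finset.card_le_card fun s hs => ?_
          obtain ⟨g, hg, hsg⟩ := hS s hs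
          exact Finset.mem_biUnion.2 ⟨g, hg, mem_fibre.2 ⟨hs, hsg⟩⟩
      _ ≤ ∑ g ∈ R₁, (fibre A S g).card := Finset.card_biUnion_le
  have cT : T.card ≤ ∑ g ∈ R₂, (fibre A T g).card := by
    calc T.card ≤ (R₂.biUnion fun g => fibre A T g).card := by
          refine Finset.card_le_card fun s hs => ?_
          obtain ⟨g, hg, hsg⟩ := hT s hs
          exact Finset.mem_biUnion.2 ⟨g, hg, mem_fibre.2 ⟨hs, hsg⟩⟩
      _ ≤ ∑ g ∈ R₂, (fibre A T g).card := Finset.card_biUnion_le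
  have cU : U.card ≤ ∑ g ∈ R₃, (fibre A U g).card := by
    calc U.card ≤ (R₃.biUnion fun g => fibre A U g).card := by
          refine Finset.card_le_card fun s hs => ?_
          obtain ⟨g, hg, hsg⟩ := hU s hs
          exact Finset.mem_biUnion.2 ⟨g, hg, mem_fibre.2 ⟨hs, hsg⟩⟩
      _ ≤ ∑ g ∈ R₃, (fibre A U g).card := Finset.card_biUnion_le
  calc S.card * T.card * U.card
      ≤ (∑ g₁ ∈ R₁, (fibre A S g₁).card) * (∑ g₂ ∈ R₂, (fibre A T g₂).card) *
          (∑ g₃ ∈ R₃, (fibre A U g₃).card) := by gcongr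
    _ = ∑ g₁ ∈ R₁, ∑ g₂ ∈ R₂, ∑ g₃ ∈ R₃,
          (fibre A S g₁).card * (fibre A T g₂).card * (fibre A U g₃).card := by
        rw [Finset.sum_mul_sum, Finset.sum_mul]
        refine Finset.sum_congr rfl fun g₁ _ => ?_
        rw [Finset.sum_mul]
        refine Finset.sum_congr rfl fun g₂ _ => ?_
        rw [Finset.mul_sum]
    _ ≤ ∑ g₁ ∈ R₁, ∑ g₂ ∈ R₂, ∑ g₃ ∈ R₃, Nat.card A := by
        gcongr with g₁ _ g₂ _ g₃ _
        exact abelian_coset_squeeze A hA h g₁ g₂ g₃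
    _ = R₁.card * R₂.card * R₃.card * Nat.card A := by
        simp only [Finset.sum_const, smul_eq_mul]
        ring

end Squeeze

/-! ## 2. Level-one vocabulary on `GL₂(𝔽_p)` (verbatim shape of the crux's inlined clauses) -/

section LevelOne

/-- `GL_m(𝔽_p)`. -/
abbrev GLm (p m : ℕ) : Type := Matrix.GeneralLinearGroup (Fin m) (ZMod p)
/-- `M_m(𝔽_p)`. -/
abbrev Mat (p m : ℕ) : Type := Matrix (Fin m) (Fin m) (ZMod p)

variable {p m : ℕ}

/-- `g ↦ Σ_M c_M ψ(tr(M g))`. -/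
def fourierFn [Fact p.Prime] (c : Mat p m → ℂ) (g : GLm p m) : ℂ :=
  ∑ M : Mat p m, c M * ZMod.stdAddChar (Matrix.trace (M * (g : Mat p m)))

/-- Fourier rank `≤ k`. -/
def RankSupp [Fact p.Prime] (k : ℕ) (c : Mat p m → ℂ) : Prop := ∀ M : Mat p m, k < M.rank → c M = 0

/-- `F_k`-separation, the crux's first clause. -/
def RankSep [Fact p.Prime] (k : ℕ) (X Y Z : Finset (GLm p m)) : Prop :=
  ∀ x₀ ∈ X, ∀ z₀ ∈ Z, ∃ c : Mat p m → ℂ, RankSupp k c ∧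
    ∀ x ∈ X, ∀ y ∈ Y, ∀ y' ∈ Y, ∀ z ∈ Z,
      fourierFn c (x⁻¹ * y * y'⁻¹ * z) = if x = x₀ ∧ y = y' ∧ z = z₀ then 1 else 0

/-- The quadruple-product set `P = X⁻¹ Y Y⁻¹ Z`. -/
def quadProducts (X Y Z : Finset (GLm p m)) : Finset (GLm p m) :=
  ((X ×ˢ Y) ×ˢ (Y ×ˢ Z)).image fun q => q.1.1⁻¹ * q.1.2 * q.2.1⁻¹ * q.2.2

/-- The crux, unfolded in this vocabulary (by `Iff.rfl`: nothing drifts from the filed text). -/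
theorem levelOneGL2Designs_iff :
    LevelOneGL2Designs ↔ ∃ c : ℝ, 0 < c ∧ ∀ p₀ : ℕ, ∃ (p : ℕ) (_ : Fact p.Prime), p₀ ≤ p ∧
      ∃ X Y Z : Finset (GLm p 2), RankSep 1 X Y Z ∧
        c * (p : ℝ) ^ (3 / 2 : ℝ) ≤ X.card ∧ c * (p : ℝ) ^ (3 / 2 : ℝ) ≤ Y.card ∧
        c * (p : ℝ) ^ (3 / 2 : ℝ) ≤ Z.card :=
  Iff.rfl

variable [Fact p.Prime]

/-- Two-sided translate of a coefficient table (parent Disproof, verbatim). -/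
def transl (a b : GLm p m) (c : Mat p m → ℂ) : Mat p m → ℂ :=
  fun N => c (((a⁻¹ : GLm p m) : Mat p m) * N * ((b⁻¹ : GLm p m) : Mat p m))

/-- `M ↦ a M b` as a permutation of `M_m(𝔽_p)` (parent Disproof, verbatim). -/
def mulEquiv (a b : GLm p m) : Mat p m ≃ Mat p m where
  toFun M := (a : Mat p m) * M * (b : Mat p m)
  invFun N := ((a⁻¹ : GLm p m) : Mat p m) * N * ((b⁻¹ : GLm p m) : Mat p m)
  left_inv M := by
    show ((a⁻¹ : GLm p m) : Mat p m) * ((a : Mat p m) * M * (b : Mat p m)) * ((b⁻¹ : GLm p m) : Mat p m) = M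
    rw [Matrix.mul_assoc (a : Mat p m), Units.inv_mul_cancel_left, Units.mul_inv_cancel_right]
  right_inv N := by
    show (a : Mat p m) * (((a⁻¹ : GLm p m) : Mat p m) * N * ((b⁻¹ : GLm p m) : Mat p m)) * (b : Mat p m) = N
    rw [Matrix.mul_assoc ((a⁻¹ : GLm p m) : Mat p m), Units.mul_inv_cancel_left, Units.inv_mul_cancel_right]

/-- `F_k` is bi-invariant (parent Disproof, verbatim). -/
theorem fourierFn_transl (a b : GLm p m) (c : Mat p m → ℂ) (g : GLm p m) :
    fourierFn (transl a b c) g = fourierFn c (b * g * a) := by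
  unfold fourierFn transl
  rw [← Equiv.sum_comp (mulEquiv a b)]
  refine Finset.sum_congr rfl fun M _ => ?_
  simp only [mulEquiv, Equiv.coe_fn_mk]
  congr 1
  · congr 1
    rw [Matrix.mul_assoc (a : Mat p m), Units.inv_mul_cancel_left, Units.mul_inv_cancel_right]
  · congr 1
    rw [Units.val_mul, Units.val_mul,
      show (a : Mat p m) * M * (b : Mat p m) * (g : Mat p m) = (a : Mat p m) * (M * (b : Mat p m) * (g : Mat p m)) by
        simp only [Matrix.mul_assoc],
      Matrix.trace_mul_comm]
    simp only [Matrix.mul_assoc]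

theorem rank_transl_arg (a b : GLm p m) (N : Mat p m) :
    (((a⁻¹ : GLm p m) : Mat p m) * N * ((b⁻¹ : GLm p m) : Mat p m)).rank = N.rank := by
  have ha : IsUnit (((a⁻¹ : GLm p m) : Mat p m)).det :=
    (Matrix.isUnit_iff_isUnit_det _).mp (Units.isUnit _)
  have hb : IsUnit (((b⁻¹ : GLm p m) : Mat p m)).det :=
    (Matrix.isUnit_iff_isUnit_det _).mp (Units.isUnit _)
  rw [Matrix.rank_mul_eq_left_of_isUnit_det _ _ hb, Matrix.rank_mul_eq_right_of_isUnit_det _ _ ha]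

theorem rankSupp_transl {k : ℕ} (a b : GLm p m) {c : Mat p m → ℂ} (hc : RankSupp k c) :
    RankSupp k (transl a b c) := fun N hN => hc _ (by rwa [rank_transl_arg])

/-- **SLICE IDENTITY (fix `x = x₀`).**  In a rank-`k`-separated triple, for every `x₀ ∈ X` the set
`Z` is level-`k` ISOLATED inside `Q(Y)·Z`: for each `z₀ ∈ Z` there is a rank-`≤ k` test equal to
`[y = y' ∧ z = z₀]` at `y y'⁻¹ z`.  (Left-translate the separator of `(x₀, z₀)` by `x₀`.)  This is the
two-set necessary condition behind the pair sieve of card `centre-checksum-sections`; by symmetry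
(`z = z₀`) `X⁻¹` is isolated inside `X⁻¹ Q(Y)`, and (`x = x₀ ∧ z = z₀`) `1` is isolated in `Q(Y)`. -/
theorem sep_slice_YZ {k : ℕ} {X Y Z : Finset (GLm p m)} (hsep : RankSep k X Y Z)
    {x₀ : GLm p m} (hx₀ : x₀ ∈ X) :
    ∀ z₀ ∈ Z, ∃ c : Mat p m → ℂ, RankSupp k c ∧ ∀ y ∈ Y, ∀ y' ∈ Y, ∀ z ∈ Z,
      fourierFn c (y * y'⁻¹ * z) = if y = y' ∧ z = z₀ then 1 else 0 := by
  intro z₀ hz₀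
  obtain ⟨c, hc, hsepc⟩ := hsep x₀ hx₀ z₀ hz₀
  refine ⟨transl 1 x₀⁻¹ c, rankSupp_transl _ _ hc, fun y hy y' hy' z hz => ?_⟩
  rw [fourierFn_transl, mul_one, show x₀⁻¹ * (y * y'⁻¹ * z) = x₀⁻¹ * y * y'⁻¹ * z by group,
    hsepc x₀ hx₀ y hy y' hy' z hz]
  simp

/-- **SLICE IDENTITY (fix `x = x₀` and `z = z₀`).**  `1` is level-`k` isolated in the quotient set
`Q(Y) = Y Y⁻¹` of the MIDDLE set. -/
theorem sep_slice_Y {k : ℕ} {X Y Z : Finset (GLm p m)} (hsep : RankSep k X Y Z)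
    {x₀ z₀ : GLm p m} (hx₀ : x₀ ∈ X) (hz₀ : z₀ ∈ Z) :
    ∃ c : Mat p m → ℂ, RankSupp k c ∧ ∀ y ∈ Y, ∀ y' ∈ Y,
      fourierFn c (y * y'⁻¹) = if y = y' then 1 else 0 := by
  obtain ⟨c, hc, hsepc⟩ := hsep x₀ hx₀ z₀ hz₀
  refine ⟨transl z₀ x₀⁻¹ c, rankSupp_transl _ _ hc, fun y hy y' hy' => ?_⟩
  rw [fourierFn_transl, show x₀⁻¹ * (y * y'⁻¹) * z₀ = x₀⁻¹ * y * y'⁻¹ * z₀ by group,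
    hsepc x₀ hx₀ y hy y' hy' z₀ hz₀]
  simp

/-- **NEAR-ISOTROPY AT THE CRITICAL LEVEL (card `det-twist-near-isotropy`).**  For `p` odd and a
rank-1-separated triple in `GL₂(𝔽_p)` with `Y ≠ ∅`:
`|X|·|Z| + |X⁻¹ Y Y⁻¹ Z| ≤ |GL₂(𝔽_p)| + (p+1)²`.
The parent crux's isotropy bound needs `2k < m`; at `(m,k) = (2,1)` the product `F_1·F_1` is
everything, but twisting by `θ∘det` (`θ ≠ 1`) leaks into `F_1` only through the single block
`π(θ⁻¹,1)`, so the twisted Gram matrix of the separators has rank `≤ (p+1)²` instead of `0`.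
Informal proof in the card; NOT yet formalised. -/
theorem nearIsotropy_levelOne (hp : p ≠ 2) {X Y Z : Finset (GLm p 2)} (hsep : RankSep 1 X Y Z)
    (hY : Y.Nonempty) :
    X.card * Z.card + (quadProducts X Y Z).card ≤ Fintype.card (GLm p 2) + (p + 1) ^ 2 := by
  sorry

/-! ## 3. Relations kill targets; the RECTANGLE relation (found while predicting probe F, 04:10Z) -/

/-- On `P = X⁻¹YY⁻¹Z` a separating function of the target `(x₀,z₀)` is the delta function of `x₀⁻¹z₀`
(parent Disproof `sep_apply_of_mem_quadProducts`, same proof). -/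
theorem sep_apply_of_mem_quadProducts {X Y Z : Finset (GLm p m)} {x₀ z₀ : GLm p m}
    (hx₀ : x₀ ∈ X) (hz₀ : z₀ ∈ Z) {c : Mat p m → ℂ}
    (hsepc : ∀ x ∈ X, ∀ y ∈ Y, ∀ y' ∈ Y, ∀ z ∈ Z,
      fourierFn c (x⁻¹ * y * y'⁻¹ * z) = if x = x₀ ∧ y = y' ∧ z = z₀ then 1 else 0)
    {g : GLm p m} (hg : g ∈ quadProducts X Y Z) :
    fourierFn c g = if g = x₀⁻¹ * z₀ then 1 else 0 := by
  classical
  rw [quadProducts, Finset.mem_image] at hg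
  obtain ⟨⟨⟨x, y⟩, ⟨y', z⟩⟩, hq, rfl⟩ := hg
  simp only [Finset.mem_product] at hq
  rw [hsepc x hq.1.1 y hq.1.2 y' hq.2.1 z hq.2.2]
  by_cases h : x⁻¹ * y * y'⁻¹ * z = x₀⁻¹ * z₀
  · rw [if_pos h]
    have h1 := hsepc x₀ hx₀ y hq.1.2 y hq.1.2 z₀ hz₀
    rw [if_pos ⟨rfl, rfl, rfl⟩, show x₀⁻¹ * y * y⁻¹ * z₀ = x₀⁻¹ * z₀ by group, ← h,
      hsepc x hq.1.1 y hq.1.2 y' hq.2.1 z hq.2.2] at h1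
    exact h1
  · rw [if_neg h, if_neg]
    rintro ⟨rfl, rfl, rfl⟩
    exact h (by group)

/-- **Relations supported in `P` kill the targets they touch.**  If `ρ : G → ℂ` is orthogonal to every
level-`k` test function, is supported inside `P = X⁻¹YY⁻¹Z`, and does not vanish at a target `x₀⁻¹z₀`,
then `(X,Y,Z)` is NOT rank-`k` separated.  (The abstract form of every non-separability certificate; the
rectangle below is the first concrete `ρ` at level one.) -/
theorem not_rankSep_of_relation {k : ℕ} {X Y Z : Finset (GLm p m)} {x₀ z₀ : GLm p m}
    (hx₀ : x₀ ∈ X) (hz₀ : z₀ ∈ Z) (ρ : GLm p m → ℂ)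
    (hρ : ∀ c : Mat p m → ℂ, RankSupp k c → ∑ g, ρ g * fourierFn c g = 0)
    (hsupp : ∀ g, ρ g ≠ 0 → g ∈ quadProducts X Y Z) (ht : ρ (x₀⁻¹ * z₀) ≠ 0) :
    ¬ RankSep k X Y Z := by
  classical
  intro hsep
  obtain ⟨c, hc, hsepc⟩ := hsep x₀ hx₀ z₀ hz₀
  have hsum := hρ c hc
  have hval : ∀ g, ρ g * fourierFn c g = if g = x₀⁻¹ * z₀ then ρ g else 0 := by
    intro g
    by_cases hρg : ρ g = 0
    · simp [hρg]
    · rw [sep_apply_of_mem_quadProducts hx₀ hz₀ hsepc (hsupp g hρg)]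
      by_cases hgt : g = x₀⁻¹ * z₀ <;> simp [hgt]
  simp_rw [hval] at hsum
  rw [Finset.sum_ite_eq'] at hsum
  simp at hsum
  exact ht hsum

/-- The four upper-unipotent cosets `diag(a,d)·U⁺` of a TORUS RECTANGLE `{a,a'} × {d,d'}`, as a signed
indicator on `GL₂(𝔽_p)`: `+1` on `diag(a,d)U⁺` and `diag(a',d')U⁺`, `−1` on `diag(a,d')U⁺` and
`diag(a',d)U⁺` (membership in `diag(s,t)U⁺` ⇔ lower-left entry `0`, diagonal `(s,t)`). -/
def rectangle (a a' d d' : ZMod p) (g : GLm p 2) : ℂ :=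
  if (g : Mat p 2) 1 0 = 0 then
    (if (g : Mat p 2) 0 0 = a ∧ (g : Mat p 2) 1 1 = d then 1 else 0)
    - (if (g : Mat p 2) 0 0 = a ∧ (g : Mat p 2) 1 1 = d' then 1 else 0)
    - (if (g : Mat p 2) 0 0 = a' ∧ (g : Mat p 2) 1 1 = d then 1 else 0)
    + (if (g : Mat p 2) 0 0 = a' ∧ (g : Mat p 2) 1 1 = d' then 1 else 0)
  else 0

/-- **RECTANGLE RELATION (level one).**  For `a ≠ a'`, `d ≠ d'` (all non-zero) the torus rectangle of
`U⁺`-cosets is orthogonal to every rank-`≤ 1` test function: on each fibre `{g : g u = v}` the four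
cosets cancel in pairs (`u = e₁`: `diag(a,·)` vs `diag(a,·)`; `u = (λ,1)`: the affine lines `y = d, d', d,
d'` with signs `+ − − +`).  STATEMENT ONLY here (informal proof in NOTES § RECTANGLE OBSTRUCTION); with
`not_rankSep_of_relation` it kills every design whose quadruple-product set contains a rectangle through a
target — in particular the whole subgroup template `(U⁻⋊μ_{m₁}, K', U⁺⋊μ_{m₃})`, `m₁, m₃ ≥ 2`, and
`(Aff⁺, T₂, U⁻)` (kit j008119), while `(S₁U⁻, 1, U⁺)` (one torus direction only) escapes it. -/
theorem rectangle_orth {a a' d d' : ZMod p} (ha : a ≠ 0) (ha' : a' ≠ 0) (hd : d ≠ 0) (hd' : d' ≠ 0)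
    (haa : a ≠ a') (hdd : d ≠ d') :
    ∀ c : Mat p 2 → ℂ, RankSupp 1 c → ∑ g, rectangle a a' d d' g * fourierFn c g = 0 := by
  sorry

end LevelOne

end Summit.MatrixMultiplication.MatrixMultiplication.Cruxes.LevelOneGL2Designs.Ideator2

end
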